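import Summits.QuantumAdvantage.QuantumAdvantage.Theorems.LinnikCubicClassGroupsDegreeOnePrimesEscapeClassPNTDHSmoothedDecayCore
import Summits.QuantumAdvantage.QuantumAdvantage.Theorems.LinnikCubicClassGroupsDegreeOnePrimesEscapeClassPNTDHSmoothedDecayPrelims
import Summits.QuantumAdvantage.QuantumAdvantage.Theorems.LinnikCubicClassGroupsDegreeOnePrimesEscapeClassPNTDecayNumericsDH
import HarnessLib

/-!
# The class prime number theorem with DECAYING error, II: the smoothed class sums

Topic `Summits/QuantumAdvantage/QuantumAdvantage/Theorems`, cell B2b-1 (linnik-cubic), PART A (gen 32);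
helper toward the crux `DegreeOnePrimesEscape` (stmt-QuantumAdvantage-11543) of route
`LinnikCubicClassGroups`.  HONEST FRAMING: the value of this file is a THEOREM (kernel-checked,
GRH-free) — NOT summit progress (the route still rests on the hypothesis-type target
`PureCubicClassNumberHard`).

`smoothedClassSum_decay` is the DECAYING-ERROR twin of `smoothedClassSum_dichotomy_dh`
(`…ClassPNTDHSmoothed.lean`).  There, given the Deuring–Heilbronn phenomenon (hypothesis `hDH`, the
statement of `Literature.NumberTheory.LFunctions.NumberField.deuringHeilbronn` verbatim) and the family density
bound in `Q`-form, the smoothed class sums `h ψ̃_C` were shown to be within `η x` (resp.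
`η x min(1, (1 − β₁) log x)` in the exceptional case) of their main terms for `x ≥ Q^{a₁(η)}`, for each FIXED
`η > 0`.  Here the dependence on `x` is kept, as in [ThornerZaman2019, §5, proof of Thm. 5.1]: with the decay
shape

  `𝓓_κ(x) = e^{−κ log x / log Q} + e^{−√(κ log x)}`      (`Q = |d_K| n^n`, `κ = κ(n) > 0`),

for every number field `K` of degree `n` obeying the density bound and every `x ≥ Q^{a₁}`, `a₁ = a₁(n)`:
(A) if NO zero of the family lies on the exceptional segment `excRegion c K`, then
  `‖h ψ̃_C(g_x) − F(−1)‖ ≤ A x 𝓓_κ(x)` for every class `C`;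
(B) if `ρ₁` is a zero of `F_{ψ₁}` on the exceptional segment, then `ρ₁ = β₁` is real, `ψ₁` is real, and
  `‖h ψ̃_C(g_x) − F(−1) + ψ₁(C⁻¹) F(−β₁)‖ ≤ A x 𝓓_κ(x) · min(1, (1 − β₁) log x)` for every class `C`.
The zero terms off the segment are bounded by `fam_zeroSum_le_local_zfr` with the classical zero-free constant
when `(1 − β₁) log x` is not small and with the Deuring–Heilbronn constant
`c_Z = min(log(1/(2Cn(1 − β₁) log x))/(Cn), a log Q/2)` (`zfr_of_zeroRepulsion`) when it is
(`dhRegime_zeroSum_decay`), through the core estimate `smoothedClassSum_decay_core`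
(`…ClassPNTDHSmoothedDecayCore.lean`); the junk terms `A_J x^{1−ν}` are `≤ A_J x e^{−(ν/4) log x} · c₁Q^{−2}`
(`rpow_one_sub_decay`) and `c₁ Q^{−2} ≤ 1 − β₁` is Stark's effective bound.
References: J. Thorner, A. Zaman, Algebra Number Theory 13 (2019), Thm. 1.4 / §5 [ThornerZaman2019];
J. C. Lagarias, H. L. Montgomery, A. M. Odlyzko, Invent. Math. 54 (1979), §7 [LagariasMontgomeryOdlyzko1979];
A. Weiss, J. reine angew. Math. 338 (1983) [Weiss1983].
-/

noncomputable section

open Complex Real MeasureTheory Set Filter Topology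
open scoped NumberField nonZeroDivisors

namespace Summit.QuantumAdvantage.QuantumAdvantage.Theorems.DegreeOnePrimesEscape

open Literature.NumberTheory.LFunctions Literature.NumberTheory.LFunctions.NumberField
  Literature.NumberTheory.LFunctions.EntireEF Literature.NumberTheory.LFunctions.TZWeight
  Literature.NumberTheory.LFunctions.AbelianDensity

set_option maxHeartbeats 3200000 in
/-- **The smoothed class sums of a number field of degree `n`, two-sided, with the exceptional zero of the
family, the Deuring–Heilbronn phenomenon and DECAYING error** (see the module docstring).
[cite: ThornerZaman2019, Theorem 1.4 and §5] [cite: LagariasMontgomeryOdlyzko1979, §7] -/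
theorem smoothedClassSum_decay (n : ℕ) (hn : 1 < n) {b D a : ℝ} (hb : 0 < b) (hD : 0 < D)
    (ha : 1 ≤ a)
    (hDH : ∃ C : ℝ, 0 < C ∧ ∀ (K : Type) [Field K] [NumberField K] (χ₁ : ClassGroup (𝓞 K) →* ℂˣ),
      χ₁ * χ₁ = 1 → ∀ β₁ : ℝ, 0 < β₁ → β₁ < 1 → classGroupLFunction K χ₁ β₁ = 0 →
      ∀ (χ : ClassGroup (𝓞 K) →* ℂˣ) (ρ : ℂ), classGroupLFunction K χ ρ = 0 → 1 / 2 ≤ ρ.re → ρ ≠ 1 →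
        ρ ≠ β₁ →
        Real.log (1 / (C * (Real.log ((NumberField.discr K).natAbs : ℝ) +
            Module.finrank ℚ K * (Real.log (|ρ.im| + 2) + 1)) * (1 - β₁))) /
          (C * (Real.log ((NumberField.discr K).natAbs : ℝ) +
            Module.finrank ℚ K * (Real.log (|ρ.im| + 2) + 1))) ≤ 1 - ρ.re) :
    ∃ ν a₁ c κ A : ℝ, 0 < ν ∧ ν ≤ 1 / 64 ∧ 1 ≤ a₁ ∧ 0 < c ∧ c ≤ 1 / (8 * ((n : ℝ) ^ 2 + 1)) ∧
      0 < κ ∧ 0 < A ∧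
    ∀ (K : Type) [Field K] [NumberField K], Module.finrank ℚ K = n →
      (∀ (T : ℝ), 1 ≤ T → ∀ u : AddChar (Additive (ClassGroup (𝓞 K))) ℂ → Finset ℂ,
        (∀ ψ, ∀ ρ ∈ u ψ, famF K ψ ρ = 0 ∧ 1 / 4 ≤ ρ.re ∧ ρ.re < 1 ∧ |ρ.im| ≤ T) →
        ∀ α : ℝ, α ≤ 1 →
          ∑ ψ, ∑ ρ ∈ u ψ with α ≤ ρ.re, (famMult K ψ ρ : ℝ) ≤
            D * Real.exp (b * (a * Real.log (ThornerZaman.condQn K) + Real.log (T + 4))) ^ (1 - α)) →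
      ((∀ (ψ : AddChar (Additive (ClassGroup (𝓞 K))) ℂ) (ρ : ℂ), famF K ψ ρ = 0 → 0 < ρ.re →
          ρ.re < 1 → ¬ excRegion c K ρ) →
        ∀ x : ℝ, ThornerZaman.condQn K ^ a₁ ≤ x → ∀ C : ClassGroup (𝓞 K),
          ‖(NumberField.classNumber K : ℂ) *
              (smoothedPsiClass K C (tzTest (Real.log x) (x ^ (-ν))) : ℂ) -
            fordLaplace (tzTest (Real.log x) (x ^ (-ν))) (-1)‖ ≤
            A * x * (Real.exp (-(κ * Real.log x / Real.log (ThornerZaman.condQn K))) +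
              Real.exp (-Real.sqrt (κ * Real.log x)))) ∧
      (∀ (ψ₁ : AddChar (Additive (ClassGroup (𝓞 K))) ℂ) (ρ₁ : ℂ), famF K ψ₁ ρ₁ = 0 → 0 < ρ₁.re →
          ρ₁.re < 1 → excRegion c K ρ₁ →
        ρ₁ = ((ρ₁.re : ℝ) : ℂ) ∧ (toMulHom ψ₁).toHomUnits * (toMulHom ψ₁).toHomUnits = 1 ∧
        ∀ x : ℝ, ThornerZaman.condQn K ^ a₁ ≤ x → ∀ C : ClassGroup (𝓞 K),
          ‖(NumberField.classNumber K : ℂ) *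
                (smoothedPsiClass K C (tzTest (Real.log x) (x ^ (-ν))) : ℂ) -
              fordLaplace (tzTest (Real.log x) (x ^ (-ν))) (-1) +
              ψ₁ (Additive.ofMul C⁻¹) * fordLaplace (tzTest (Real.log x) (x ^ (-ν))) (-(ρ₁.re : ℂ))‖ ≤
            A * x * (Real.exp (-(κ * Real.log x / Real.log (ThornerZaman.condQn K))) +
              Real.exp (-Real.sqrt (κ * Real.log x))) * min 1 ((1 - ρ₁.re) * Real.log x)) := by
  classical
  obtain ⟨ν, aC, A₀, AJ, hν0, hν64, haC32, hA₀, hAJ0, hcoreK⟩ := smoothedClassSum_decay_core n hn hb hD ha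
  obtain ⟨c₀, hc₀, hpack⟩ := exists_exceptionalZero_const n
  obtain ⟨C, hC, hDH'⟩ := hDH
  obtain ⟨c₁, hc₁, hc₁1, heff⟩ := Residue.one_sub_realZero_ge_condQn_rpow n hn
  have hn2 : (2 : ℝ) ≤ n := by exact_mod_cast hn
  have hn0 : (0 : ℝ) < n := by linarith
  set c : ℝ := min c₀ (1 / (8 * ((n : ℝ) ^ 2 + 1))) with hcdef
  have hc : 0 < c := lt_min hc₀ (by positivity)
  have hcc₀ : c ≤ c₀ := min_le_left _ _
  have hcn : c ≤ 1 / (8 * ((n : ℝ) ^ 2 + 1)) := min_le_right _ _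
  -- the regime threshold (no longer depending on a target accuracy)
  set cu : ℝ := min 1 (1 / (6 * C * n)) with hcu
  have hcu0 : 0 < cu := lt_min one_pos (by positivity)
  have hcu1 : cu ≤ 1 := min_le_left _ _
  have hcuC : cu ≤ 1 / (6 * C * n) := min_le_right _ _
  -- the decay rate and the constant
  set κ : ℝ := min (c / (4 * a)) (min (ν / 4) (1 / (32 * a * (C * n + 1)))) with hκdef
  have hκ0 : 0 < κ := lt_min (by positivity) (lt_min (by positivity) (by positivity))
  have hκc : κ ≤ c / (4 * a) := min_le_left _ _
  have hκν : κ ≤ ν / 4 := (min_le_right _ _).trans (min_le_left _ _)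
  have hκDH : κ ≤ 1 / (32 * a * (C * n + 1)) := (min_le_right _ _).trans (min_le_right _ _)
  set A : ℝ := (A₀ + AJ) / cu + ((6 * C * n + 1) * A₀ + AJ) with hAdef
  have hA0 : 0 < A := by positivity
  have hAcu : (A₀ + AJ) / cu ≤ A := by
    have : 0 ≤ (6 * C * n + 1) * A₀ + AJ := by positivity
    linarith
  have hA1 : A₀ + AJ ≤ A := by
    refine le_trans ?_ hAcu
    rw [le_div_iff₀ hcu0]
    have : (A₀ + AJ) * cu ≤ (A₀ + AJ) * 1 := mul_le_mul_of_nonneg_left hcu1 (by positivity)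
    linarith
  have hA2 : (6 * C * n + 1) * A₀ + AJ ≤ A := by
    have : 0 ≤ (A₀ + AJ) / cu := by positivity
    linarith
  -- thresholds
  set ΛJ : ℝ := (8 + 4 * max 0 (Real.log (1 / c₁))) / ν with hΛJ
  set Λ₁ : ℝ := 8 * a * C * n with hΛ₁
  set Λ₂ : ℝ := 32 * C * n + 16 * C * n * max 0 (Real.log (1 / (2 * C * n * c₁))) with hΛ₂
  set Λ₃ : ℝ := 32 * (2 + max 0 (Real.log (1 / c₁))) ^ 2 with hΛ₃
  set a₁ : ℝ := max (max aC ΛJ) (max (max Λ₁ Λ₂) Λ₃) with ha₁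
  have ha₁aC : aC ≤ a₁ := le_trans (le_max_left _ _) (le_max_left _ _)
  have ha₁32 : (32 : ℝ) ≤ a₁ := haC32.trans ha₁aC
  have ha₁J : ΛJ ≤ a₁ := le_trans (le_max_right _ _) (le_max_left _ _)
  have ha₁1' : Λ₁ ≤ a₁ := le_trans (le_trans (le_max_left _ _) (le_max_left _ _)) (le_max_right _ _)
  have ha₁2' : Λ₂ ≤ a₁ := le_trans (le_trans (le_max_right _ _) (le_max_left _ _)) (le_max_right _ _)
  have ha₁3' : Λ₃ ≤ a₁ := le_trans (le_max_right _ _) (le_max_right _ _)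
  have ha₁1 : (1 : ℝ) ≤ a₁ := by linarith
  refine ⟨ν, a₁, c, κ, A, hν0, hν64, ha₁1, hc, hcn, hκ0, hA0, fun K _ _ hKn hdens ↦ ?_⟩
  have hK : 1 < Module.finrank ℚ K := by rw [hKn]; exact hn
  set Q : ℝ := ThornerZaman.condQn K with hQ
  have hQ12 : (12 : ℝ) ≤ Q := ThornerZaman.twelve_le_condQn (K := K) hK
  have hQ1 : (1 : ℝ) < Q := by linarith
  have hQ0 : (0 : ℝ) < Q := by linarith
  have hlogQ : 2 ≤ Real.log Q := two_lt_log_twelve.le.trans (Real.log_le_log (by norm_num) hQ12)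
  have hlogQ0 : 0 < Real.log Q := by linarith
  have hlogQ1 : 1 ≤ Real.log Q := by linarith
  have hhQ : (NumberField.classNumber K : ℝ) ≤ Q ^ 4 := by
    have := ThornerZaman.classNumber_le_condQn_pow (K := K) hK; rw [← hQ] at this; exact this
  have hQm2 : Q ^ (-(2 : ℝ)) ≤ 1 := Real.rpow_le_one_of_one_le_of_nonpos hQ1.le (by norm_num)
  have hQm2' : 0 < Q ^ (-(2 : ℝ)) := Real.rpow_pos_of_pos hQ0 _
  have hQexp2 : Q ^ (-(2 : ℝ)) = Real.exp (-(2 * Real.log Q)) := by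
    rw [Real.rpow_def_of_pos hQ0]; ring_nf
  have hm'1 : c₁ * Q ^ (-(2 : ℝ)) ≤ 1 := (mul_le_mul hc₁1 hQm2 hQm2'.le zero_le_one).trans (by norm_num)
  have hm'0 : 0 < c₁ * Q ^ (-(2 : ℝ)) := mul_pos hc₁ hQm2'
  obtain ⟨hLPreal, hLPuniq, hLPsimple⟩ := hpack K hKn
  have hzfr_c : ∀ (x : ℝ) (ψ : AddChar (Additive (ClassGroup (𝓞 K))) ℂ) (ρ : ℂ), famF K ψ ρ = 0 →
      1 / 4 ≤ ρ.re → ρ.re < 1 → |ρ.im| ≤ x → ¬ excRegion c K ρ →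
        ρ.re ≤ 1 - c / (a * Real.log (ThornerZaman.condQn K) + Real.log (|ρ.im| + 4)) :=
    fun x ψ ρ h0 _ _ _ hexc ↦ zfr_classical_Qform hc hcc₀ ha hLPreal ψ h0 hexc
  -- the core estimate: zero sum with zero-free constant `cZ` plus the junk term `AJ x^{1-ν}`
  have hcore : ∀ x : ℝ, Q ^ a₁ ≤ x → ∀ (Cl : ClassGroup (𝓞 K))
      (Exc : AddChar (Additive (ClassGroup (𝓞 K))) ℂ → Finset ℂ),
      (∀ ψ, ∀ ρ ∈ Exc ψ, famF K ψ ρ = 0 ∧ 0 < ρ.re ∧ ρ.re < 1) →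
      (∀ ψ ρ, famF K ψ ρ = 0 → 0 < ρ.re → ρ.re < 1 → excRegion c K ρ → ρ ∈ Exc ψ) →
      ∀ cZ : ℝ, 0 < cZ →
      (∀ (ψ : AddChar (Additive (ClassGroup (𝓞 K))) ℂ) (ρ : ℂ), famF K ψ ρ = 0 → 1 / 4 ≤ ρ.re →
        ρ.re < 1 → |ρ.im| ≤ x → ¬ excRegion c K ρ →
          ρ.re ≤ 1 - cZ / (a * Real.log (ThornerZaman.condQn K) + Real.log (|ρ.im| + 4))) →
      ‖(NumberField.classNumber K : ℂ) * (smoothedPsiClass K Cl (tzTest (Real.log x) (x ^ (-ν))) : ℂ) -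
          fordLaplace (tzTest (Real.log x) (x ^ (-ν))) (-1) +
          ∑ ψ : AddChar (Additive (ClassGroup (𝓞 K))) ℂ, ψ (Additive.ofMul Cl⁻¹) *
            ∑ ρ ∈ Exc ψ, (famMult K ψ ρ : ℂ) * fordLaplace (tzTest (Real.log x) (x ^ (-ν))) (-ρ)‖ ≤
        x * (A₀ * (Real.exp (-(cZ * Real.log x / (4 * a * Real.log Q))) +
          Real.exp (-Real.sqrt (cZ * Real.log x / 4)))) +
          AJ * (x * Real.exp (-(ν / 4 * Real.log x)) * (c₁ * Q ^ (-(2 : ℝ)))) := by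
    intro x hx Cl Exc hExc hExc' cZ hcZ hzfr
    have hxaC : Q ^ aC ≤ x := le_trans (Real.rpow_le_rpow_of_exponent_le hQ1.le ha₁aC) hx
    have key := hcoreK K hKn hdens c x hxaC Cl Exc hExc hExc' cZ hcZ hzfr
    have hdec : x ^ (1 - ν) ≤ x * Real.exp (-(ν / 4 * Real.log x)) * (c₁ * Q ^ (-(2 : ℝ))) :=
      rpow_one_sub_decay (a := a₁) hQ12 hx hν0 (by linarith) hc₁ (by rw [← hΛJ]; exact ha₁J)
    have := mul_le_mul_of_nonneg_left hdec hAJ0.le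
    rw [← hQ] at key
    linarith
  -- common sizes at `x ≥ Q^{a₁}`
  have hsz : ∀ x : ℝ, Q ^ a₁ ≤ x → 1 < x ∧ a₁ * Real.log Q ≤ Real.log x ∧ 64 ≤ Real.log x := by
    intro x hx
    have hxQ : Q ≤ x := by
      have : Q ^ (1 : ℝ) ≤ Q ^ a₁ := Real.rpow_le_rpow_of_exponent_le hQ1.le ha₁1
      rw [Real.rpow_one] at this; linarith
    have hx1 : 1 < x := by linarith
    have hLQ : a₁ * Real.log Q ≤ Real.log x := by
      have := Real.log_le_log (by positivity) hx
      rwa [Real.log_rpow (by linarith)] at this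
    exact ⟨hx1, hLQ, by nlinarith⟩
  -- notation for the decay shape at rate `κ'`
  have hDmono : ∀ {κ' : ℝ} (x : ℝ), 1 < x → κ ≤ κ' →
      Real.exp (-(κ' * Real.log x / Real.log Q)) + Real.exp (-Real.sqrt (κ' * Real.log x)) ≤
        Real.exp (-(κ * Real.log x / Real.log Q)) + Real.exp (-Real.sqrt (κ * Real.log x)) :=
    fun x hx1 hκ' ↦ decayShape_mono (Real.log_pos hx1).le hlogQ0 hκ'
  -- the classical zero-sum term and the junk term are below `x 𝓓_κ`
  have hclass : ∀ x : ℝ, 1 < x →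
      x * (A₀ * (Real.exp (-(c * Real.log x / (4 * a * Real.log Q))) +
        Real.exp (-Real.sqrt (c * Real.log x / 4)))) ≤
        A₀ * x * (Real.exp (-(κ * Real.log x / Real.log Q)) + Real.exp (-Real.sqrt (κ * Real.log x))) := by
    intro x hx1
    have h := zeroSum_classical_decay hc.le ha (Real.log_pos hx1).le hlogQ0 hκc
    have hx0 : (0 : ℝ) ≤ x := by linarith
    calc x * (A₀ * (Real.exp (-(c * Real.log x / (4 * a * Real.log Q))) +
          Real.exp (-Real.sqrt (c * Real.log x / 4))))
        = A₀ * x * (Real.exp (-(c * Real.log x / (4 * a * Real.log Q))) +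
          Real.exp (-Real.sqrt (c * Real.log x / 4))) := by ring
      _ ≤ _ := mul_le_mul_of_nonneg_left h (by positivity)
  have hjunkD : ∀ x : ℝ, 1 < x →
      x * Real.exp (-(ν / 4 * Real.log x)) ≤
        x * (Real.exp (-(κ * Real.log x / Real.log Q)) + Real.exp (-Real.sqrt (κ * Real.log x))) := by
    intro x hx1
    have hL0 : 0 ≤ Real.log x := (Real.log_pos hx1).le
    have h1 : Real.exp (-(ν / 4 * Real.log x)) ≤
        Real.exp (-(ν / 4 * Real.log x / Real.log Q)) + Real.exp (-Real.sqrt (ν / 4 * Real.log x)) :=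
      exp_neg_mul_le_decayShape (by positivity) hL0 hlogQ1
    exact mul_le_mul_of_nonneg_left (h1.trans (hDmono x hx1 hκν)) (by linarith)
  refine ⟨?_, ?_⟩
  · -- (A) no exceptional zero
    intro hnoexc x hx Cl
    obtain ⟨hx1, hLQ, hL64⟩ := hsz x hx
    have hx0 : 0 < x := by linarith
    have key := hcore x hx Cl (fun _ ↦ ∅) (fun ψ ρ hρ ↦ by simp at hρ)
      (fun ψ ρ h0 h1 h2 hexc ↦ absurd hexc (hnoexc ψ ρ h0 h1 h2)) c hc (hzfr_c x)
    simp only [Finset.sum_empty, mul_zero, Finset.sum_const_zero, add_zero] at key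
    have h1 := hclass x hx1
    have h2 : AJ * (x * Real.exp (-(ν / 4 * Real.log x)) * (c₁ * Q ^ (-(2 : ℝ)))) ≤
        AJ * x * (Real.exp (-(κ * Real.log x / Real.log Q)) + Real.exp (-Real.sqrt (κ * Real.log x))) := by
      have h3 : x * Real.exp (-(ν / 4 * Real.log x)) * (c₁ * Q ^ (-(2 : ℝ))) ≤
          x * Real.exp (-(ν / 4 * Real.log x)) * 1 :=
        mul_le_mul_of_nonneg_left hm'1 (by positivity)
      rw [mul_one] at h3
      have := mul_le_mul_of_nonneg_left (h3.trans (hjunkD x hx1)) hAJ0.le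
      linarith
    have hD0 : 0 ≤ x * (Real.exp (-(κ * Real.log x / Real.log Q)) + Real.exp (-Real.sqrt (κ * Real.log x))) := by
      positivity
    have h4 : (A₀ + AJ) * (x * (Real.exp (-(κ * Real.log x / Real.log Q)) +
        Real.exp (-Real.sqrt (κ * Real.log x)))) ≤
        A * (x * (Real.exp (-(κ * Real.log x / Real.log Q)) + Real.exp (-Real.sqrt (κ * Real.log x)))) :=
      mul_le_mul_of_nonneg_right hA1 hD0
    linarith [key, h1, h2, h4]
  · -- (B) an exceptional zero `(ψ₁, ρ₁)`: real, unique, simple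
    intro ψ₁ ρ₁ h0₁ hre₁ hre₁' hexc₁
    obtain ⟨hρ₁, hreal₁, hmult, hβhalf, hLzero, hexcβ⟩ :=
      exceptionalZero_facts (K := K) hn hcc₀ hcn hLPreal hLPsimple ψ₁ h0₁ hre₁' hexc₁
    set β₁ : ℝ := ρ₁.re with hβ₁
    set χ₁ : ClassGroup (𝓞 K) →* ℂˣ := (toMulHom ψ₁).toHomUnits with hχ₁
    have hβ1 : β₁ < 1 := hre₁'
    have hβ0 : 0 < β₁ := by linarith
    have hδlow : c₁ * Q ^ (-(2 : ℝ)) ≤ 1 - β₁ := heff K hKn χ₁ hreal₁ β₁ hβ1 hLzero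
    have hrep := hDH' K χ₁ hreal₁ β₁ hβ0 hβ1 hLzero
    refine ⟨hρ₁, hreal₁, fun x hx Cl ↦ ?_⟩
    obtain ⟨hExc, hExc', hsumΦ⟩ := excUpdate_spec (K := K) hcc₀ hLPuniq ψ₁ h0₁ hre₁ hre₁' hexc₁ hmult
    set Exc : AddChar (Additive (ClassGroup (𝓞 K))) ℂ → Finset ℂ :=
      Function.update (fun _ ↦ (∅ : Finset ℂ)) ψ₁ {ρ₁} with hExcdef
    have hsum : ∑ ψ : AddChar (Additive (ClassGroup (𝓞 K))) ℂ, ψ (Additive.ofMul Cl⁻¹) *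
        ∑ ρ ∈ Exc ψ, (famMult K ψ ρ : ℂ) * fordLaplace (tzTest (Real.log x) (x ^ (-ν))) (-ρ) =
        ψ₁ (Additive.ofMul Cl⁻¹) * fordLaplace (tzTest (Real.log x) (x ^ (-ν))) (-(β₁ : ℂ)) := by
      have h := hsumΦ Cl (fun ρ ↦ fordLaplace (tzTest (Real.log x) (x ^ (-ν))) (-ρ))
      rw [h, ← hρ₁]
    obtain ⟨hx1, hLQ, hL64⟩ := hsz x hx
    have hx0 : 0 < x := by linarith
    have hxQ : Q ≤ x := by
      have : Q ^ (1 : ℝ) ≤ Q ^ a₁ := Real.rpow_le_rpow_of_exponent_le hQ1.le ha₁1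
      rw [Real.rpow_one] at this; linarith
    have hL1 : 1 ≤ Real.log x := by linarith
    have hL0 : 0 < Real.log x := by linarith
    have hL4 : 4 ≤ Real.log x := by linarith
    have hδ₁0 : 0 < 1 - β₁ := by linarith
    have hη₁0 : 0 < (1 - β₁) * Real.log x := mul_pos hδ₁0 hL0
    have hδη : 1 - β₁ ≤ (1 - β₁) * Real.log x := by
      have := mul_le_mul_of_nonneg_left hL1 hδ₁0.le; rw [mul_one] at this; exact this
    have hη₁low : c₁ * Q ^ (-(2 : ℝ)) ≤ (1 - β₁) * Real.log x := hδlow.trans hδη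
    have hη₁m : c₁ * Q ^ (-(2 : ℝ)) ≤ min 1 ((1 - β₁) * Real.log x) := le_min hm'1 hη₁low
    have hm0 : 0 ≤ min 1 ((1 - β₁) * Real.log x) := le_min zero_le_one hη₁0.le
    -- the decay shape at `x`
    set Dκ : ℝ := Real.exp (-(κ * Real.log x / Real.log Q)) + Real.exp (-Real.sqrt (κ * Real.log x)) with hDκ
    have hDκ0 : 0 < Dκ := by positivity
    have hAxD : 0 ≤ A * x * Dκ * min 1 ((1 - β₁) * Real.log x) := by positivity
    -- the junk term is `≤ AJ x 𝓓_κ · min(1, (1-β₁) log x)`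
    have hjunkm : AJ * (x * Real.exp (-(ν / 4 * Real.log x)) * (c₁ * Q ^ (-(2 : ℝ)))) ≤
        AJ * x * Dκ * min 1 ((1 - β₁) * Real.log x) := by
      have h1 := hjunkD x hx1
      have h2 : x * Real.exp (-(ν / 4 * Real.log x)) * (c₁ * Q ^ (-(2 : ℝ))) ≤
          x * Dκ * min 1 ((1 - β₁) * Real.log x) :=
        mul_le_mul h1 hη₁m hm'0.le (by positivity)
      have := mul_le_mul_of_nonneg_left h2 hAJ0.le
      linarith
    rcases le_or_gt cu ((1 - β₁) * Real.log x) with hA' | hB'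
    · -- regime A: `(1 − β₁) log x ≥ cu` — the classical zero-free region suffices
      have key := hcore x hx Cl Exc hExc hExc' c hc (hzfr_c x)
      rw [hsum] at key
      have hmcu : cu ≤ min 1 ((1 - β₁) * Real.log x) := le_min hcu1 hA'
      have h1 := hclass x hx1
      -- `A₀ x 𝓓 ≤ (A₀/cu) x 𝓓 min`, `AJ x 𝓓 min ≤ …`
      have h2 : A₀ * x * Dκ ≤ A₀ / cu * x * Dκ * min 1 ((1 - β₁) * Real.log x) := by
        have e : A₀ * x * Dκ = A₀ / cu * x * Dκ * cu := by field_simp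
        rw [e]
        exact mul_le_mul_of_nonneg_left hmcu (by positivity)
      have h3 : A₀ / cu * x * Dκ * min 1 ((1 - β₁) * Real.log x) + AJ * x * Dκ * min 1 ((1 - β₁) * Real.log x)
          ≤ A * x * Dκ * min 1 ((1 - β₁) * Real.log x) := by
        have hAJcu : AJ ≤ AJ / cu := by
          rw [le_div_iff₀ hcu0]
          have : AJ * cu ≤ AJ * 1 := mul_le_mul_of_nonneg_left hcu1 hAJ0.le
          linarith
        have e : A₀ / cu * x * Dκ * min 1 ((1 - β₁) * Real.log x) +
            AJ * x * Dκ * min 1 ((1 - β₁) * Real.log x) =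
            (A₀ / cu + AJ) * (x * Dκ * min 1 ((1 - β₁) * Real.log x)) := by ring
        rw [e, show A * x * Dκ * min 1 ((1 - β₁) * Real.log x) =
          A * (x * Dκ * min 1 ((1 - β₁) * Real.log x)) by ring]
        refine mul_le_mul_of_nonneg_right ?_ (by positivity)
        have : A₀ / cu + AJ / cu = (A₀ + AJ) / cu := by field_simp
        linarith
      rw [hDκ] at h2 h3 hjunkm
      linarith [key, h1, h2, h3, hjunkm]
    · -- regime B: `(1 − β₁) log x < cu` — the Deuring–Heilbronn zero-free region
      have hη₁1 : (1 - β₁) * Real.log x ≤ 1 := hB'.le.trans hcu1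
      have hmin : min 1 ((1 - β₁) * Real.log x) = (1 - β₁) * Real.log x := min_eq_right hη₁1
      have hsmall : 2 * C * n * ((1 - β₁) * Real.log x) ≤ 1 / 3 := by
        have h1 : 2 * C * n * ((1 - β₁) * Real.log x) ≤ 2 * C * n * cu :=
          mul_le_mul_of_nonneg_left hB'.le (by positivity)
        have h2 : 2 * C * n * cu ≤ 2 * C * n * (1 / (6 * C * n)) :=
          mul_le_mul_of_nonneg_left hcuC (by positivity)
        have h3 : 2 * C * n * (1 / (6 * C * n)) = 1 / 3 := by field_simp; ring
        linarith
      have hcZ0 : 0 < min (Real.log (1 / (2 * C * n * ((1 - β₁) * Real.log x))) / (C * n))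
          (a * Real.log Q / 2) := by
        refine lt_min (div_pos (Real.log_pos ?_) (by positivity)) (by positivity)
        have h0 : 0 < 2 * C * n * ((1 - β₁) * Real.log x) := by positivity
        rw [lt_div_iff₀ h0]; linarith
      have hzfr : ∀ (ψ : AddChar (Additive (ClassGroup (𝓞 K))) ℂ) (ρ : ℂ), famF K ψ ρ = 0 →
          1 / 4 ≤ ρ.re → ρ.re < 1 → |ρ.im| ≤ x → ¬ excRegion c K ρ →
            ρ.re ≤ 1 - min (Real.log (1 / (2 * C * n * ((1 - β₁) * Real.log x))) / (C * n))
              (a * Real.log Q / 2) / (a * Real.log Q + Real.log (|ρ.im| + 4)) :=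
        zfr_of_zeroRepulsion (K := K) hn hKn hC (c := c) (a := a) ha hexcβ hβ1 hxQ hL4 hrep hsmall
      have key := hcore x hx Cl Exc hExc hExc' _ hcZ0 hzfr
      rw [hsum] at key
      have hη₁low' : c₁ * Real.exp (-(2 * Real.log Q)) ≤ (1 - β₁) * Real.log x := by
        rw [← hQexp2]; exact hη₁low
      have hzs := dhRegime_zeroSum_decay (A₀ := A₀) (C := C) (n := (n : ℝ))
        (η₁ := (1 - β₁) * Real.log x) (c₁ := c₁) (a := a) (lQ := Real.log Q) (L := Real.log x) (a₁ := a₁)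
        hA₀ hC hn2 hc₁ ha hlogQ1 hη₁0 hη₁low' hsmall hLQ
        (by rw [← hΛ₁]; exact ha₁1') (by rw [← hΛ₂]; exact ha₁2') (by rw [← hΛ₃]; exact ha₁3')
      -- the Deuring–Heilbronn decay rate is `≥ κ`
      have hDH_D := hDmono x hx1 hκDH
      have h1 : x * (A₀ * (Real.exp (-(min (Real.log (1 / (2 * C * n * ((1 - β₁) * Real.log x))) / (C * n))
          (a * Real.log Q / 2) * Real.log x / (4 * a * Real.log Q))) +
          Real.exp (-Real.sqrt (min (Real.log (1 / (2 * C * n * ((1 - β₁) * Real.log x))) / (C * n))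
          (a * Real.log Q / 2) * Real.log x / 4)))) ≤
          (6 * C * n + 1) * A₀ * x * Dκ * ((1 - β₁) * Real.log x) := by
        have h2 := mul_le_mul_of_nonneg_left hzs hx0.le
        refine h2.trans ?_
        have h3 : (6 * C * n + 1) * A₀ * ((1 - β₁) * Real.log x) *
            (Real.exp (-(1 / (32 * a * (C * n + 1)) * Real.log x / Real.log Q)) +
              Real.exp (-Real.sqrt (1 / (32 * a * (C * n + 1)) * Real.log x))) ≤
            (6 * C * n + 1) * A₀ * ((1 - β₁) * Real.log x) * Dκ :=
          mul_le_mul_of_nonneg_left hDH_D (by positivity)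
        have := mul_le_mul_of_nonneg_left h3 hx0.le
        have e : x * ((6 * C * n + 1) * A₀ * ((1 - β₁) * Real.log x) * Dκ) =
            (6 * C * n + 1) * A₀ * x * Dκ * ((1 - β₁) * Real.log x) := by ring
        linarith
      have h3 : (6 * C * n + 1) * A₀ * x * Dκ * ((1 - β₁) * Real.log x) +
          AJ * x * Dκ * ((1 - β₁) * Real.log x) ≤ A * x * Dκ * ((1 - β₁) * Real.log x) := by
        have e : (6 * C * n + 1) * A₀ * x * Dκ * ((1 - β₁) * Real.log x) +
            AJ * x * Dκ * ((1 - β₁) * Real.log x) =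
            ((6 * C * n + 1) * A₀ + AJ) * (x * Dκ * ((1 - β₁) * Real.log x)) := by ring
        rw [e, show A * x * Dκ * ((1 - β₁) * Real.log x) = A * (x * Dκ * ((1 - β₁) * Real.log x)) by ring]
        exact mul_le_mul_of_nonneg_right hA2 (by positivity)
      rw [hmin] at hjunkm ⊢
      rw [hDκ] at h1 h3 hjunkm
      linarith [key, h1, h3, hjunkm]

end Summit.QuantumAdvantage.QuantumAdvantage.Theorems.DegreeOnePrimesEscape

end
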